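import Summits.MatrixMultiplication.MatrixMultiplication.Theorems.OutsiderSandwichToricCeilingPowTwoCwBaseDataA
import Summits.MatrixMultiplication.MatrixMultiplication.Theorems.OutsiderSandwichToricCeilingPowTwoCwBaseDataTwoA

/-!
# OutsiderSandwich — toric ceiling of `cw₂^{⊠N}`: the `N = 3` two-cw base, TWO-NESS census A
(groups `cX0`, `cX1`, `cX2`; decomp-mm lens 4, gen 47, kernel K47-8 census A; THESES-FREE, `ω`-free;
helper toward `LaserTangency`, stmt-32268)

LABEL.  TORIC · FINITE (`N = 3`) · NEC-side instrument.  For each group `cXk`, in CHUNKS of at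
most 120 instances (kernel memory ceiling on the gate): the second certificate `datbk[i]`
(`…TwoCwBaseDataTwoA`) decodes to a `valid` perfect matching of the instance `(instOf cXk)[i]`
which misses a row of the matching decoded from the first certificate `datak[i]`
(`…TwoCwBaseDataA`) — `census₂_k_r`, `decide +kernel`, standard axioms (no `native_decide`, no
`ofReduceBool`); `lenbk`, `dlenbk`, `cover₂_k` are bookkeeping.  Consumed by `…TwoCwBaseTwo`.
WHAT THIS IS NOT: no statement about tensors or `ω`.
-/

set_option linter.dupNamespace false
set_option maxRecDepth 200000
set_option Elab.async false

namespace Summit.MatrixMultiplication.MatrixMultiplication.Theorems.OutsiderSandwichToricCeilingPowTwoCwBaseCensusTwoA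

open Summit.MatrixMultiplication.MatrixMultiplication.Theorems.OutsiderSandwichToricCeilingPowTwoCwBaseDefs
open Summit.MatrixMultiplication.MatrixMultiplication.Theorems.OutsiderSandwichToricCeilingPowTwoCwBaseDataA
open Summit.MatrixMultiplication.MatrixMultiplication.Theorems.OutsiderSandwichToricCeilingPowTwoCwBaseDataTwoA

set_option maxHeartbeats 0 in
/-- Group `cX0`: the second-certificate list has the length of the instance list (360). -/
theorem lenb0 : (instOf cX0).length = datb0.length := by
  decide +kernel

/-- Group `cX0`: number of second certificates. -/
theorem dlenb0 : datb0.length = 360 := by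
  decide +kernel

set_option maxHeartbeats 0 in
/-- TWO-NESS CENSUS, group `cX0`, instances `0 … 119` (kernel-decided): each second
certificate decodes to a valid perfect matching missing a row of the first one. -/
theorem census₂_0_0 : ((((instOf cX0).zip (data0.zip datb0)).drop 0).take 120).all
    (fun p => goodD₂ p.1 p.2.1 p.2.2) = true := by
  decide +kernel

set_option maxHeartbeats 0 in
/-- TWO-NESS CENSUS, group `cX0`, instances `120 … 239` (kernel-decided): each second
certificate decodes to a valid perfect matching missing a row of the first one. -/
theorem census₂_0_1 : ((((instOf cX0).zip (data0.zip datb0)).drop 120).take 120).all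
    (fun p => goodD₂ p.1 p.2.1 p.2.2) = true := by
  decide +kernel

set_option maxHeartbeats 0 in
/-- TWO-NESS CENSUS, group `cX0`, instances `240 … 359` (kernel-decided): each second
certificate decodes to a valid perfect matching missing a row of the first one. -/
theorem census₂_0_2 : ((((instOf cX0).zip (data0.zip datb0)).drop 240).take 120).all
    (fun p => goodD₂ p.1 p.2.1 p.2.2) = true := by
  decide +kernel

/-- Group `cX0`: every index is covered by a decided chunk. -/
theorem cover₂_0 : ∀ i < datb0.length, ∃ lo n, lo ≤ i ∧ i < lo + n ∧
    ((((instOf cX0).zip (data0.zip datb0)).drop lo).take n).all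
      (fun p => goodD₂ p.1 p.2.1 p.2.2) = true := by
  intro i hi
  rw [dlenb0] at hi
  by_cases h0 : i < 120
  · exact ⟨0, 120, by omega, by omega, census₂_0_0⟩
  by_cases h1 : i < 240
  · exact ⟨120, 120, by omega, by omega, census₂_0_1⟩
  · exact ⟨240, 120, by omega, by omega, census₂_0_2⟩

set_option maxHeartbeats 0 in
/-- Group `cX1`: the second-certificate list has the length of the instance list (184). -/
theorem lenb1 : (instOf cX1).length = datb1.length := by
  decide +kernel

/-- Group `cX1`: number of second certificates. -/
theorem dlenb1 : datb1.length = 184 := by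
  decide +kernel

set_option maxHeartbeats 0 in
/-- TWO-NESS CENSUS, group `cX1`, instances `0 … 119` (kernel-decided): each second
certificate decodes to a valid perfect matching missing a row of the first one. -/
theorem census₂_1_0 : ((((instOf cX1).zip (data1.zip datb1)).drop 0).take 120).all
    (fun p => goodD₂ p.1 p.2.1 p.2.2) = true := by
  decide +kernel

set_option maxHeartbeats 0 in
/-- TWO-NESS CENSUS, group `cX1`, instances `120 … 183` (kernel-decided): each second
certificate decodes to a valid perfect matching missing a row of the first one. -/
theorem census₂_1_1 : ((((instOf cX1).zip (data1.zip datb1)).drop 120).take 64).all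
    (fun p => goodD₂ p.1 p.2.1 p.2.2) = true := by
  decide +kernel

/-- Group `cX1`: every index is covered by a decided chunk. -/
theorem cover₂_1 : ∀ i < datb1.length, ∃ lo n, lo ≤ i ∧ i < lo + n ∧
    ((((instOf cX1).zip (data1.zip datb1)).drop lo).take n).all
      (fun p => goodD₂ p.1 p.2.1 p.2.2) = true := by
  intro i hi
  rw [dlenb1] at hi
  by_cases h0 : i < 120
  · exact ⟨0, 120, by omega, by omega, census₂_1_0⟩
  · exact ⟨120, 64, by omega, by omega, census₂_1_1⟩

set_option maxHeartbeats 0 in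
/-- Group `cX2`: the second-certificate list has the length of the instance list (376). -/
theorem lenb2 : (instOf cX2).length = datb2.length := by
  decide +kernel

/-- Group `cX2`: number of second certificates. -/
theorem dlenb2 : datb2.length = 376 := by
  decide +kernel

set_option maxHeartbeats 0 in
/-- TWO-NESS CENSUS, group `cX2`, instances `0 … 119` (kernel-decided): each second
certificate decodes to a valid perfect matching missing a row of the first one. -/
theorem census₂_2_0 : ((((instOf cX2).zip (data2.zip datb2)).drop 0).take 120).all
    (fun p => goodD₂ p.1 p.2.1 p.2.2) = true := by
  decide +kernel

set_option maxHeartbeats 0 in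
/-- TWO-NESS CENSUS, group `cX2`, instances `120 … 239` (kernel-decided): each second
certificate decodes to a valid perfect matching missing a row of the first one. -/
theorem census₂_2_1 : ((((instOf cX2).zip (data2.zip datb2)).drop 120).take 120).all
    (fun p => goodD₂ p.1 p.2.1 p.2.2) = true := by
  decide +kernel

set_option maxHeartbeats 0 in
/-- TWO-NESS CENSUS, group `cX2`, instances `240 … 359` (kernel-decided): each second
certificate decodes to a valid perfect matching missing a row of the first one. -/
theorem census₂_2_2 : ((((instOf cX2).zip (data2.zip datb2)).drop 240).take 120).all
    (fun p => goodD₂ p.1 p.2.1 p.2.2) = true := by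
  decide +kernel

set_option maxHeartbeats 0 in
/-- TWO-NESS CENSUS, group `cX2`, instances `360 … 375` (kernel-decided): each second
certificate decodes to a valid perfect matching missing a row of the first one. -/
theorem census₂_2_3 : ((((instOf cX2).zip (data2.zip datb2)).drop 360).take 16).all
    (fun p => goodD₂ p.1 p.2.1 p.2.2) = true := by
  decide +kernel

/-- Group `cX2`: every index is covered by a decided chunk. -/
theorem cover₂_2 : ∀ i < datb2.length, ∃ lo n, lo ≤ i ∧ i < lo + n ∧
    ((((instOf cX2).zip (data2.zip datb2)).drop lo).take n).all
      (fun p => goodD₂ p.1 p.2.1 p.2.2) = true := by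
  intro i hi
  rw [dlenb2] at hi
  by_cases h0 : i < 120
  · exact ⟨0, 120, by omega, by omega, census₂_2_0⟩
  by_cases h1 : i < 240
  · exact ⟨120, 120, by omega, by omega, census₂_2_1⟩
  by_cases h2 : i < 360
  · exact ⟨240, 120, by omega, by omega, census₂_2_2⟩
  · exact ⟨360, 16, by omega, by omega, census₂_2_3⟩

end Summit.MatrixMultiplication.MatrixMultiplication.Theorems.OutsiderSandwichToricCeilingPowTwoCwBaseCensusTwoA
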